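import Summits.ValiantsHypothesis.ValiantsHypothesis.Theorems.LacunarySymmetroidMatrixDescartesCensusDoorA34NullNullEndCells
import Summits.ValiantsHypothesis.ValiantsHypothesis.Theorems.LacunarySymmetroidMatrixDescartesCensusDoorA34SheetWindowOrdered

/-!
# `MatrixDescartes` census — DOOR A at `(3,4)`: on EVERY WINDOW-ORDERED support (`3·d₂ < d₃`: the whole hierarchical regime, all rails) a null-null seventeen
# cannot have SEMIDEFINITE END LETTERS OF OPPOSITE SIGNS (`S₀ ⪰ 0 ∧ S₃ ⪯ 0`, or `S₀ ⪯ 0 ∧ S₃ ⪰ 0` ⇒ `Z₊ ≤ 16`)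

HONEST FRAMING.  Object-search cell `pub-symmetroid`, engine seat `val-sym-eng-2` (g5); helper rows beside the registered strata line
`Cruxes/DoorA34/Lines/strata.lean` on stmt-ValiantsHypothesis-19980 (`DoorA34 = PosRootLawAt 3 4 18`: OPEN, typed, never asserted here); third stub
`stub_nullNullCeiling`.  Companion of …NullNullEndCells (`card_posRoots_le_16_of_nullNull_psd_nsd` / `_nsd_psd`: the cell is closed whenever the two end slots
`{0,0,3}`, `{0,3,3}` have sheet ranks of EQUAL parity).  On a window-ordered support these ranks are chamber-free — `ρ(d₃+2d₀) = 9`, `ρ(2d₃+d₀) = 15` (the null-null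
sheet has the `18` slots `≠ {0,0,0}, {3,3,3}`; block bounds of …SheetWindowOrdered) — both odd:

* `card_nullNull_slots_top_not_mem` (= 9), `card_nullNull_slots_count_top_le_one` (= 15) (`decide`);
* `nullNullRank_midBottom_of_windowOrdered`, `nullNullRank_topBottom_of_windowOrdered` (on a null-null seventeen);
* **`card_posRoots_le_16_of_nullNull_windowOrdered_oppositeEnds`** — `StrictMono d`, `3·d 2 < d 3`, symmetric letters, `det S₀ = det S₃ = 0`, the two end letters
  semidefinite of OPPOSITE signs ⇒ `Z₊ ≤ 16`.  (The kernel sixteen p583093 on `(0,1,4,100)` lives on such a support.)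

Nothing here bounds anything else; `DoorA34` and the three stubs stay OPEN; registers unchanged; nothing on `MatrixDescartes` (stmt-ValiantsHypothesis-18050) or `VP ≠ VNP` —
VP≠VNP not moved.  [folklore] Descartes bookkeeping; elementary.
-/

-- `Summit.ValiantsHypothesis.ValiantsHypothesis.…` repeats a component by the D-0017 layout
-- (single-conjunct summit), which the `dupNamespace` linter flags; the name is mandated.
set_option linter.dupNamespace false

namespace Summit.ValiantsHypothesis.ValiantsHypothesis.Theorems.LacunarySymmetroidMatrixDescartes.Census

open Polynomial Finset Matrix
open scoped BigOperators Polynomial Matrix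

/-- Among the `18` null-null slots, `9` avoid the top letter. [folklore] -/
theorem card_nullNull_slots_top_not_mem :
    ((((Finset.univ : Finset (Sym (Fin 4) 3)).erase (Sym.replicate 3 3)).erase (Sym.replicate 3 0)).filter
      (fun s : Sym (Fin 4) 3 => (3 : Fin 4) ∉ (s : Multiset (Fin 4)))).card = 9 := by
  decide

/-- Among the `18` null-null slots, `15` contain the top letter at most once. [folklore] -/
theorem card_nullNull_slots_count_top_le_one :
    ((((Finset.univ : Finset (Sym (Fin 4) 3)).erase (Sym.replicate 3 3)).erase (Sym.replicate 3 0)).filter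
      (fun s : Sym (Fin 4) 3 => Multiset.count (3 : Fin 4) (s : Multiset (Fin 4)) ≤ 1)).card = 15 := by
  decide

/-- **`ρ(d₃ + 2d₀) = 9`** on a window-ordered support (null-null seventeen). [folklore] -/
theorem nullNullRank_midBottom_of_windowOrdered (d : Fin 4 → ℕ) (hd : StrictMono d) (hwin : 3 * d 2 < d 3) (S : Fin 4 → Matrix (Fin 3) (Fin 3) ℝ)
    (h0 : (S 0).det = 0) (h3 : (S 3).det = 0) (h17 : 17 ≤ ((Matrix.det (∑ l, ((X : ℝ[X]) ^ d l) • (S l).map C)).roots.toFinset.filter (fun t => 0 < t)).card) :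
    ((Matrix.det (∑ l, ((X : ℝ[X]) ^ d l) • (S l).map C)).support.filter (· < d 3 + 2 * d 0)).card = 9 := by
  classical
  have hinj := sym_sum_injOn_of_nullNull_seventeen d S h0 h3 h17
  set E := ((Finset.univ : Finset (Sym (Fin 4) 3)).erase (Sym.replicate 3 3)).erase (Sym.replicate 3 0) with hE
  set σ : Sym (Fin 4) 3 → ℕ := fun s => ((s : Multiset (Fin 4)).map d).sum with hσ
  have hfilt : (Matrix.det (∑ l, ((X : ℝ[X]) ^ d l) • (S l).map C)).support.filter (· < d 3 + 2 * d 0)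
      = (E.filter (fun s : Sym (Fin 4) 3 => (3 : Fin 4) ∉ (s : Multiset (Fin 4)))).image σ := by
    rw [support_det_pencil_eq_of_nullNull_seventeen d S h0 h3 h17]
    ext c
    simp only [Finset.mem_filter, Finset.mem_image]
    constructor
    · rintro ⟨⟨s, hs, rfl⟩, hlt⟩
      refine ⟨s, ⟨hs, ?_⟩, rfl⟩
      intro hmem
      have := sym_sum_ge_mid_of_top_mem d hd s hmem
      exact absurd hlt (not_lt.mpr this)
    · rintro ⟨s, ⟨hs, hnot⟩, rfl⟩
      refine ⟨⟨s, hs, rfl⟩, ?_⟩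
      have := sym_sum_le_core_of_top_not_mem d hd s hnot
      show ((s : Multiset (Fin 4)).map d).sum < d 3 + 2 * d 0
      omega
  rw [hfilt, Finset.card_image_of_injOn (hinj.mono (by intro s hs; exact (Finset.mem_filter.mp hs).1))]
  exact card_nullNull_slots_top_not_mem

/-- **`ρ(2d₃ + d₀) = 15`** on a window-ordered support (null-null seventeen). [folklore] -/
theorem nullNullRank_topBottom_of_windowOrdered (d : Fin 4 → ℕ) (hd : StrictMono d) (hwin : 3 * d 2 < d 3) (S : Fin 4 → Matrix (Fin 3) (Fin 3) ℝ)
    (h0 : (S 0).det = 0) (h3 : (S 3).det = 0) (h17 : 17 ≤ ((Matrix.det (∑ l, ((X : ℝ[X]) ^ d l) • (S l).map C)).roots.toFinset.filter (fun t => 0 < t)).card) :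
    ((Matrix.det (∑ l, ((X : ℝ[X]) ^ d l) • (S l).map C)).support.filter (· < 2 * d 3 + d 0)).card = 15 := by
  classical
  have hinj := sym_sum_injOn_of_nullNull_seventeen d S h0 h3 h17
  set E := ((Finset.univ : Finset (Sym (Fin 4) 3)).erase (Sym.replicate 3 3)).erase (Sym.replicate 3 0) with hE
  set σ : Sym (Fin 4) 3 → ℕ := fun s => ((s : Multiset (Fin 4)).map d).sum with hσ
  have hfilt : (Matrix.det (∑ l, ((X : ℝ[X]) ^ d l) • (S l).map C)).support.filter (· < 2 * d 3 + d 0)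
      = (E.filter (fun s : Sym (Fin 4) 3 => Multiset.count (3 : Fin 4) (s : Multiset (Fin 4)) ≤ 1)).image σ := by
    rw [support_det_pencil_eq_of_nullNull_seventeen d S h0 h3 h17]
    ext c
    simp only [Finset.mem_filter, Finset.mem_image]
    constructor
    · rintro ⟨⟨s, hs, rfl⟩, hlt⟩
      refine ⟨s, ⟨hs, ?_⟩, rfl⟩
      by_contra hgt
      have := sym_sum_ge_of_two_tops d hd s (by omega)
      exact absurd hlt (not_lt.mpr this)
    · rintro ⟨s, ⟨hs, hcnt⟩, rfl⟩
      refine ⟨⟨s, hs, rfl⟩, ?_⟩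
      have := sym_sum_le_of_count_top_le_one d hd s hcnt
      show ((s : Multiset (Fin 4)).map d).sum < 2 * d 3 + d 0
      omega
  rw [hfilt, Finset.card_image_of_injOn (hinj.mono (by intro s hs; exact (Finset.mem_filter.mp hs).1))]
  exact card_nullNull_slots_count_top_le_one

/-- **WINDOW-ORDERED NULL-NULL SEVENTEENS HAVE NO OPPOSITE-SIGN SEMIDEFINITE ENDS.**  `StrictMono d`, `3·d 2 < d 3`, symmetric letters, `det S₀ = det S₃ = 0`, and
`S₀ ⪰ 0 ∧ S₃ ⪯ 0` or `S₀ ⪯ 0 ∧ S₃ ⪰ 0` ⇒ `Z₊ ≤ 16`. [folklore] -/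
theorem card_posRoots_le_16_of_nullNull_windowOrdered_oppositeEnds (d : Fin 4 → ℕ) (hd : StrictMono d) (hwin : 3 * d 2 < d 3)
    (S : Fin 4 → Matrix (Fin 3) (Fin 3) ℝ) (hS : ∀ l, (S l).IsSymm) (h0 : (S 0).det = 0) (h3 : (S 3).det = 0)
    (hends : ((S 0).PosSemidef ∧ (-(S 3)).PosSemidef) ∨ ((-(S 0)).PosSemidef ∧ (S 3).PosSemidef)) : ((Matrix.det (∑ l, ((X : ℝ[X]) ^ d l) • (S l).map C)).roots.toFinset.filter (fun t => 0 < t)).card ≤ 16 := by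
  by_contra hlt
  have h17 : 17 ≤ ((Matrix.det (∑ l, ((X : ℝ[X]) ^ d l) • (S l).map C)).roots.toFinset.filter (fun t => 0 < t)).card := by omega
  set ρ : ℕ → ℕ := fun n => ((((((Finset.univ : Finset (Sym (Fin 4) 3)).erase (Sym.replicate 3 3)).erase (Sym.replicate 3 0)).image
          (fun s : Sym (Fin 4) 3 => ((s : Multiset (Fin 4)).map d).sum)).filter (· < n)).card) with hρdef
  have hρ' : ∀ n, ρ n = ((Matrix.det (∑ l, ((X : ℝ[X]) ^ d l) • (S l).map C)).support.filter (· < n)).card := fun n => by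
    rw [hρdef, sheetRank_eq_of_nullNull_seventeen d S h0 h3 h17]
  have hpar : ρ (2 * d 0 + d 3) % 2 = ρ (2 * d 3 + d 0) % 2 := by
    rw [hρ', hρ', show 2 * d 0 + d 3 = d 3 + 2 * d 0 from by ring, nullNullRank_midBottom_of_windowOrdered d hd hwin S h0 h3 h17,
      nullNullRank_topBottom_of_windowOrdered d hd hwin S h0 h3 h17]
  rcases hends with ⟨hp0, hn3⟩ | ⟨hn0, hp3⟩
  · have := card_posRoots_le_16_of_nullNull_psd_nsd d hd S hS h0 h3 hp0 hn3 ρ (fun n => rfl) hpar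
    omega
  · have := card_posRoots_le_16_of_nullNull_nsd_psd d hd S hS h0 h3 hn0 hp3 ρ (fun n => rfl) hpar
    omega

end Summit.ValiantsHypothesis.ValiantsHypothesis.Theorems.LacunarySymmetroidMatrixDescartes.Census
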